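import Literature.Barriers.RiemannHypothesis.BeurlingCounterexamplesThm13b
import Literature.NumberTheory.BeurlingPrimes.RandomPrimeSubset
import Literature.NumberTheory.BeurlingPrimes.DeletedPrimesZeta
import Literature.NumberTheory.BeurlingPrimes.DeletedPrimesPerron
import HarnessLib

/-!
# BDR 2023, Theorem 1.3: `BrouckeDebruyneRevesz2023_thm13_holds` (and `…_thm13b_holds`)

Topic `Literature/Barriers/RiemannHypothesis`. Everything in this file is PROVED.

Broucke–Debruyne–Révész [BDR 2023, Theorem 1.3]: "Any `[α, β]`-system from Theorem 1.2 satisfies `H(𝒫) = O(𝒫) = β`.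
Furthermore, under RH there exist `[α, β]`-systems with `β < 1/2 < α`. More precisely, there are `[1/2, β]`-systems for
each `β ∈ [0, 1/2)` and on RH there are `[α, β]`-systems for each `α` and `β` with `1/2 < α < 2/3` and
`2α/(2 + α) ≤ β < 1/2`." The first family is `BrouckeDebruyneRevesz2023_thm13a_holds` (tree), and the tree's
`BrouckeDebruyneRevesz2023_thm13_of_estimates` (`BeurlingCounterexamplesThm13b.lean`) reduces the whole statement to the
analytic input `h5` of BDR §5 (pp. 15–17) for the second family: for every `α ∈ (1/2, 2/3)` (under RH) a set `𝒫_𝒮` of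
rational primes with (π) `π_𝒮(x) ≍ x^α/log x`, (N') `N'(x) = ax + O_ε(x^{2α/(α+2)+ε})` with `a > 0` for the
`𝒫_𝒮`-free integers, (I) the Abel constant `I(β) ≠ 0` for `2α/(α+2) < β < 1/2`, and (∂) no `O(x^{β₀−ε})` integer
error at the boundary `β₀ = 2α/(α+2)`.

`BrouckeDebruyneRevesz2023_estimates` supplies `h5`, following BDR §5 verbatim:
* Stage 1 (`RandomPrimeSubset.lean`): a random `S ⊆ ℙ` with `P(p ∈ S) = p^{α−1}`, the exponential-sum bound (5.1) for
  `c(p) = 1_S(p) − p^{α−1}` and Chebyshev bounds (π) (`PrimeSubset.exists_primeSubset`);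
* Stage 2 (`DeletedPrimesZeta.lean`): `ζ_𝒮(s) = ζ(s+1−α) e^{Z(s)}` with `e^{±Z} ≪ (1+|t|)^η` on `σ > α/2` and
  `ζ(s) = ζ_𝒩(s)ζ_𝒮(s)`, whence the continuation `keptZ` of `(s−1)ζ_𝒩(s)` under RH;
* Stage 3 (`WeightedPerron.lean`, `BeurlingMoebius.lean`, `DeletedPrimesPerron.lean`): Perron (proof of Thm 3.2) for
  `N_𝒮` and `N_𝒮 + M_𝒮` under RH: both `= a_𝒮 x^α + O_ε(x^{α/2+ε})`;
* Stage 4 (`DeletedPrimesHyperbola.lean`, `FreeIntegersContinuation.lean`): Lemma 5.1 (hyperbola) gives (N') with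
  `a ≥ 0`; `a = keptZ(1) ≠ 0`, `(β−1)I(β) = keptZ(β) ≠ 0` (identity theorem, `ζ(β) ≠ 0` on `(0,1)`), and the
  boundary pole argument (∂).

## References
* [BrouckeDebruyneRevesz2023] F. Broucke, G. Debruyne, Sz. Gy. Révész, *Some examples of well-behaved Beurling
  number systems*, arXiv:2309.01567, Theorem 1.3 and §5 pp. 15–17 (read: `lit read arxiv-2309.01567`, pp. 3, 14–18).
-/

noncomputable section

open Filter Set Asymptotics
open scoped Topology

namespace Literature.Barriers.RiemannHypothesis

open Literature.NumberTheory.BeurlingPrimes Literature.NumberTheory.LFunctions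

/-- `π_S` is unbounded when `π_S(x) ≥ c₀ x^α/log x` eventually (`c₀, α > 0`; `log x = o(x^α)`). [folklore] -/
theorem primeCountIn_unbounded {S : Set ℕ} {α c₀ x₀ : ℝ} (hα : 0 < α) (hc₀ : 0 < c₀)
    (hπ : ∀ x : ℝ, x₀ ≤ x → c₀ * (x ^ α / Real.log x) ≤ primeCountIn S x) (n : ℕ) :
    ∃ x : ℝ, n < primeCountIn S x := by
  have hev := (isLittleO_log_rpow_atTop hα).bound (show 0 < c₀ / (n + 1) by positivity)
  obtain ⟨x, hx, hx'⟩ := (hev.and (eventually_ge_atTop (max x₀ 2))).exists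
  have hx0 : x₀ ≤ x := (le_max_left _ _).trans hx'
  have hx2 : 2 ≤ x := (le_max_right _ _).trans hx'
  have hlog : 0 < Real.log x := Real.log_pos (by linarith)
  have hxa : 0 < x ^ α := Real.rpow_pos_of_pos (by linarith) _
  rw [Real.norm_of_nonneg hlog.le, Real.norm_of_nonneg hxa.le] at hx
  have h1 : ((n : ℝ) + 1) * Real.log x ≤ c₀ * x ^ α := by
    calc ((n : ℝ) + 1) * Real.log x ≤ ((n : ℝ) + 1) * (c₀ / (n + 1) * x ^ α) :=
          mul_le_mul_of_nonneg_left hx (by positivity)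
      _ = c₀ * x ^ α := by field_simp
  have h2 : (n : ℝ) + 1 ≤ primeCountIn S x := by
    refine le_trans ?_ (hπ x hx0)
    rw [mul_div_assoc', le_div_iff₀ hlog]
    exact h1
  exact ⟨x, by exact_mod_cast (show (n : ℝ) < primeCountIn S x by linarith)⟩

/-- **BDR §5, the analytic input for Theorem 1.3(b)** (the hypothesis `h5` of
`BrouckeDebruyneRevesz2023_thm13_of_estimates`): under RH, for every `α ∈ (1/2, 2/3)` there is a set `S = 𝒫_𝒮` of
rational primes with (π) `c x^α/log x ≤ π_𝒮(x) ≤ C x^α/log x`, a density `a > 0` of the `𝒫_𝒮`-free integers with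
(N') `N'(y) = ay + O_ε(y^{2α/(α+2)+ε})`, (I) `I(β) ≠ 0` for `2α/(α+2) < β < 1/2`, and (∂) no `O(x^{2α/(α+2)−ε})` integer
error for `𝒫_{α,2α/(α+2)}`. [cite: BrouckeDebruyneRevesz2023, §5 pp. 15–17] -/
theorem BrouckeDebruyneRevesz2023_estimates (hRH : RiemannHypothesis) (α : ℝ) (hα : 1 / 2 < α)
    (hα23 : α < 2 / 3) :
    ∃ S : Set ℕ, (∀ p ∈ S, p.Prime) ∧
      (∃ c C x₀ : ℝ, 0 < c ∧ ∀ x : ℝ, x₀ ≤ x →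
        c * (x ^ α / Real.log x) ≤ primeCountIn S x ∧
          (primeCountIn S x : ℝ) ≤ C * (x ^ α / Real.log x)) ∧
      ∃ a : ℝ, 0 < a ∧
        (∀ ε : ℝ, 0 < ε → ∃ C : ℝ, ∀ y : ℝ, 1 ≤ y →
          |(Nat.card {n : ℕ // (n ≠ 0 ∧ IsFree S n) ∧ (n : ℝ) ≤ y} : ℝ) - a * y|
            ≤ C * y ^ (2 * α / (α + 2) + ε)) ∧
        (∀ β : ℝ, 2 * α / (α + 2) < β → β < 1 / 2 → ∃ I : ℝ, I ≠ 0 ∧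
          Tendsto (fun R : ℕ ↦ ∑ n ∈ Finset.Icc 0 R, freeInd S n * (n : ℝ) ^ (-β)
            - a / (1 - β) * (R : ℝ) ^ (1 - β)) atTop (𝓝 I)) ∧
        (∀ A ε : ℝ, 0 < ε → ¬ ∃ C : ℝ, ∀ x : ℝ, 1 ≤ x →
          |(Nat.card {nm : ℕ × ℕ // (nm.1 ≠ 0 ∧ IsFree S nm.1) ∧ nm.2 ≠ 0 ∧
              (nm.1 : ℝ) * (nm.2 : ℝ) ^ (2 * α / (α + 2))⁻¹ ≤ x} : ℝ) - A * x|
            ≤ C * x ^ (2 * α / (α + 2) - ε)) := by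
  have hα0 : 0 < α := by linarith
  have hα1 : α < 1 := by linarith
  -- Stage 1: the random prime subset
  obtain ⟨S, hS, ⟨c, C, hc, hB⟩, c₀, C₀, x₀, hc₀, hπ⟩ := PrimeSubset.exists_primeSubset (α := α) hα0 hα1
  have hB' : PrimeWeight.IsBounded c (α / 2) C PrimeWeight.logGauge := hB
  have hD : (delIdx S).Infinite := delIdx_infinite hS
    (infinite_of_primeCountIn_unbounded (primeCountIn_unbounded hα0 hc₀ (fun x hx ↦ (hπ x hx).1)))
  have hT : (keptIdx S).Infinite := keptIdx_infinite hS hα1 (fun x hx ↦ (hπ x hx).2)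
  have hsum : ∀ u : ℝ, α < u → Summable fun j ↦ (delPrimeSystem S hD).prime j ^ (-u) := fun u hu ↦
    summable_delPrimeSystem_prime_rpow hS hD hα0 ⟨C₀, x₀, fun x hx ↦ (hπ x hx).2⟩ hu
  -- Stage 2: `ζ_𝒮 = ζ(s+1−α)·E`
  have hEd : DifferentiableOn ℂ (corr c α S hD) {s : ℂ | α / 2 < s.re} := differentiableOn_corr hD hα1 hB' hsum
  have hEζ : ∀ s : ℂ, 1 < s.re →
      (ratPrimes.restrict hD).zeta s = riemannZeta (s + 1 - α) * corr c α S hD s :=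
    fun s hs ↦ zeta_delPrimeSystem_eq hD hα1 hB' hc hsum hs
  have hE0 : ∀ s : ℂ, α / 2 < s.re → corr c α S hD s ≠ 0 := fun s _ ↦ corr_ne_zero hD s
  have hEb : ∀ σ₁ : ℝ, α / 2 < σ₁ → ∀ η : ℝ, 0 < η → ∃ B : ℝ, ∀ s : ℂ, σ₁ ≤ s.re → s.re ≤ 3 →
      ‖corr c α S hD s‖ ≤ B * (1 + |s.im|) ^ η ∧ ‖(corr c α S hD s)⁻¹‖ ≤ B * (1 + |s.im|) ^ η := by
    intro σ₁ hσ₁ η hη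
    obtain ⟨B, -, h⟩ := norm_corr_le hD hα1 hB' hsum hσ₁ hη
    exact ⟨B, h⟩
  -- Stage 3: Perron for `N_𝒮` and `N_𝒮 + M_𝒮`
  obtain ⟨hN, hNM⟩ := smooth_partialSum_asymptotics hRH hα hα1 hD hsum hEd hEζ hE0 hEb
  -- Stage 4a: hyperbola ⇒ `a ≥ 0` and (N')
  obtain ⟨a, ha0, -, hN'⟩ := freeCount_asymptotic (S := S) hα0 hα1 hN hNM
  -- Stage 4b: the continuation `Z` of `(s−1)ζ_𝒩(s)`
  have hZd : DifferentiableOn ℂ (keptZ c α S hD) {s : ℂ | α / 2 < s.re} :=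
    differentiableOn_keptZ hRH hD hα1 hB' hsum
  have hZeq : ∀ s : ℂ, 1 < s.re → keptZ c α S hD s = (s - 1) * (keptSystem S hT).zeta s :=
    fun s hs ↦ keptZ_eq hT hD hα1 hB' hc hsum hs
  have hZne : ∀ β : ℝ, 0 < β → β ≠ α → keptZ c α S hD β ≠ 0 :=
    fun β hβ hβα ↦ keptZ_ofReal_ne_zero hD hα1 hβ hβα
  have hγlt : 2 * α / (α + 2) < 1 / 2 := by rw [div_lt_iff₀ (by linarith)]; linarith
  have hγpos : 0 < 2 * α / (α + 2) := by positivity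
  have hγgt : α / 2 < 2 * α / (α + 2) := by rw [lt_div_iff₀ (by linarith)]; nlinarith
  refine ⟨S, hS, ⟨c₀, C₀, x₀, hc₀, hπ⟩, a, ?_, ?_, ?_, ?_⟩
  · -- `a > 0` (`a = Z(1) ≠ 0`)
    obtain ⟨C₁, hC₁⟩ := hN' (1 / 4) (by norm_num)
    have hZ1 : keptZ c α S hD 1 ≠ 0 := by
      have h := hZne 1 one_pos (by linarith)
      simpa using h
    exact density_pos_of_ne_zero hT (γ := 2 * α / (α + 2) + 1 / 4) (by linarith) ha0 hC₁
      (hZd.mono fun s hs ↦ lt_trans (show α / 2 < 2 * α / (α + 2) + 1 / 4 by linarith) hs) hZeq hZ1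
  · -- (N')
    intro ε hε
    obtain ⟨C₁, hC₁⟩ := hN' ε hε
    refine ⟨C₁, fun y hy ↦ ?_⟩
    rw [← partialSum_freeInd_eq_card S (by linarith)]
    exact hC₁ y hy
  · -- (I)
    intro β hβlo hβhi
    obtain ⟨C₁, hC₁⟩ := hN' ((β - 2 * α / (α + 2)) / 2) (by linarith)
    have hC₁' : ∀ t : ℝ, 1 ≤ t →
        |partialSum (freeInd S) t - a * t| ≤ C₁ * t ^ ((2 * α / (α + 2) + β) / 2) := by
      intro t ht
      have h := hC₁ t ht
      rwa [show 2 * α / (α + 2) + (β - 2 * α / (α + 2)) / 2 = (2 * α / (α + 2) + β) / 2 by ring] at h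
    exact exists_abelConst_ne_zero hT (by linarith) (by linarith) hC₁'
      (hZd.mono fun s hs ↦ lt_trans (show α / 2 < (2 * α / (α + 2) + β) / 2 by linarith) hs) hZeq
      (by linarith) (by linarith) (hZne β (by linarith) (ne_of_lt (by linarith)))
  · -- (∂)
    intro A ε hε
    exact not_intErrorLE_boundary hT hγpos (by linarith) hγgt hZd hZeq
      (hZne _ hγpos (ne_of_lt (by linarith))) A ε hε

/-- **Broucke–Debruyne–Révész 2023, Theorem 1.3** (both assertions; the second under RH, as stated).
[cite: BrouckeDebruyneRevesz2023, Theorem 1.3] -/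
theorem BrouckeDebruyneRevesz2023_thm13_holds : BrouckeDebruyneRevesz2023_thm13 :=
  BrouckeDebruyneRevesz2023_thm13_of_estimates fun hRH α hα hα23 ↦
    BrouckeDebruyneRevesz2023_estimates hRH α hα hα23

/-- **Broucke–Debruyne–Révész 2023, Theorem 1.3, second assertion** (the named fact `…_thm13b`).
[cite: BrouckeDebruyneRevesz2023, Theorem 1.3] -/
theorem BrouckeDebruyneRevesz2023_thm13b_holds : BrouckeDebruyneRevesz2023_thm13b :=
  BrouckeDebruyneRevesz2023_thm13b_of_thm13 BrouckeDebruyneRevesz2023_thm13_holds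

end Literature.Barriers.RiemannHypothesis
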